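import Summits.NavierStokesRegularity.NavierStokesRegularity.Theorems.CorkscrewDynamoCorkscrewProfileRelativeEquilibriumRigidity
import Summits.NavierStokesRegularity.NavierStokesRegularity.Theorems.FilamentSkeletonRssCoreGluingProfileSuffices

/-!
# Route CorkscrewDynamo · crux `CorkscrewProfile` (stmt-NavierStokesRegularity-11282) — the birth-line stub and route `FilamentSkeletonRss`

Line `birth`, lead c2. Two bridges recorded as tree theorems (registered tools stub
`stub_relativeEquilibriumBridges`), both one-liners over the rigidity equivalence
`relativeEquilibrium_iff_rotatedLerayProfile` (sibling file `…RelativeEquilibriumRigidity.lean`):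

* `rssProfileExists_of_relativeEquilibrium` — the body of the open stub `stub_relativeEquilibrium` (a
  non-`R_{ωL}`-invariant relative equilibrium of Leray's backward system in the Type-I envelope) implies the
  TARGET `RssProfileExists` of route `FilamentSkeletonRss` (stmt-NavierStokesRegularity-16274), through that
  route's landed reduction `Theorems.stub_rssProfileExists_of_profile`;
* `corkscrewProfile_of_rotatedLerayProfile` — one smooth nontrivial solution of Perelman's rotated Leray
  profile system (`α ≠ 0`, profile decay `C₀/(1+‖y‖)`, bounded pressure) — the common hypothesis of both
  routes' reductions — gives route `CorkscrewDynamo`'s crux `CorkscrewProfile` (through the landed line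
  composition `corkscrewProfile_of_relativeEquilibrium`).

So the open cores of the two routes are the same object: a Type-I rotated self-similar profile with
`α ≠ 0` (negative side of Pineau–Vicol 2026 Conjecture 1.1 = Tsai 2018 Conj. 8.9).
-/

noncomputable section

open Set Function MeasureTheory Literature.Analysis.FluidPDE

namespace Summit.NavierStokesRegularity.NavierStokesRegularity.Theorems.CorkscrewProfile.Birth

set_option linter.dupNamespace false

/-- **Bridge to route `FilamentSkeletonRss`: a corkscrew relative equilibrium is an RSS profile.** The
body of `stub_relativeEquilibrium` implies the target `FilamentSkeletonRss.RssProfileExists`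
(stmt-NavierStokesRegularity-16274), through `relativeEquilibrium_iff_rotatedLerayProfile` and the landed
`Theorems.stub_rssProfileExists_of_profile`. -/
theorem rssProfileExists_of_relativeEquilibrium
    (h : ∃ (Rot : ℝ → (EuclideanSpace ℝ (Fin 3) ≃ₗᵢ[ℝ] EuclideanSpace ℝ (Fin 3))) (ω L C : ℝ)
      (V : EuclideanSpace ℝ (Fin 3) → EuclideanSpace ℝ (Fin 3)) (Q : EuclideanSpace ℝ (Fin 3) → ℝ),
      (∀ (φ : ℝ) (x : EuclideanSpace ℝ (Fin 3)),
          Rot φ x 0 = Real.cos φ * x 0 - Real.sin φ * x 1 ∧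
          Rot φ x 1 = Real.sin φ * x 0 + Real.cos φ * x 1 ∧ Rot φ x 2 = x 2) ∧
      0 < L ∧ ContDiff ℝ (⊤ : ℕ∞) V ∧ ContDiff ℝ (⊤ : ℕ∞) Q ∧
      Literature.Analysis.FluidPDE.VectorCalculus.IsDivFree V ∧
      (∀ y : EuclideanSpace ℝ (Fin 3),
          ω • (Literature.Analysis.FluidPDE.cross (EuclideanSpace.single (2 : Fin 3) (1 : ℝ)) (V y)
                - fderiv ℝ V y (Literature.Analysis.FluidPDE.cross (EuclideanSpace.single (2 : Fin 3) (1 : ℝ)) y))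
            + (1 / 2 : ℝ) • V y + (1 / 2 : ℝ) • fderiv ℝ V y y
            + Literature.Analysis.FluidPDE.convect V V y + gradient Q y
            = Laplacian.laplacian V y) ∧
      (∀ y : EuclideanSpace ℝ (Fin 3), (1 + ‖y‖) * ‖V y‖ ≤ C) ∧
      (∀ y : EuclideanSpace ℝ (Fin 3), |Q y| ≤ C) ∧
      (∃ y : EuclideanSpace ℝ (Fin 3), Rot (ω * L) (V (Rot (-(ω * L)) y)) ≠ V y)) :
    Summit.NavierStokesRegularity.NavierStokesRegularity.Theses.FilamentSkeletonRss.RssProfileExists :=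
  Summit.NavierStokesRegularity.NavierStokesRegularity.Theorems.stub_rssProfileExists_of_profile
    (relativeEquilibrium_iff_rotatedLerayProfile.1 h)

/-- **Bridge from the profile system to the crux: one rotated Leray profile is a corkscrew.** A smooth
nontrivial divergence-free solution `(U, P)` of Perelman's rotated Leray profile system with `α ≠ 0`,
`‖U y‖ ≤ C₀/(1+‖y‖)` and bounded pressure gives route `CorkscrewDynamo`'s crux `CorkscrewProfile`
(`relativeEquilibrium_iff_rotatedLerayProfile` + the landed line composition `corkscrewProfile_of_relativeEquilibrium`).
The same hypothesis gives `FilamentSkeletonRss.RssProfileExists` (`Theorems.stub_rssProfileExists_of_profile`):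
the open cores of the two routes coincide. -/
theorem corkscrewProfile_of_rotatedLerayProfile
    (h : ∃ (α C₀ M : ℝ) (U : EuclideanSpace ℝ (Fin 3) → EuclideanSpace ℝ (Fin 3))
      (P : EuclideanSpace ℝ (Fin 3) → ℝ), α ≠ 0 ∧ U ≠ 0 ∧ ContDiff ℝ (⊤ : ℕ∞) U ∧ ContDiff ℝ (⊤ : ℕ∞) P ∧
      Literature.Analysis.FluidPDE.VectorCalculus.IsDivFree U ∧
      (∀ y : EuclideanSpace ℝ (Fin 3),
        α • (Literature.Analysis.FluidPDE.rotGen (U y) - fderiv ℝ U y (Literature.Analysis.FluidPDE.rotGen y))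
          + (1 / 2 : ℝ) • U y + (1 / 2 : ℝ) • fderiv ℝ U y y - Laplacian.laplacian U y
          + fderiv ℝ U y (U y) + gradient P y = 0) ∧
      (∀ y : EuclideanSpace ℝ (Fin 3), ‖U y‖ ≤ C₀ / (1 + ‖y‖)) ∧
      (∀ y : EuclideanSpace ℝ (Fin 3), |P y| ≤ M)) :
    Summit.NavierStokesRegularity.NavierStokesRegularity.Theses.CorkscrewDynamo.CorkscrewProfile :=
  corkscrewProfile_of_relativeEquilibrium (relativeEquilibrium_iff_rotatedLerayProfile.2 h)


/-- **Registered tools stub `stub_relativeEquilibriumBridges` of the line `birth`** (crux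
stmt-NavierStokesRegularity-11282): the body of `stub_relativeEquilibrium` implies
`FilamentSkeletonRss.RssProfileExists`, and a smooth nontrivial rotated Leray profile (`α ≠ 0`, Type-I
profile decay, bounded pressure) implies `CorkscrewDynamo.CorkscrewProfile`. -/
theorem stub_relativeEquilibriumBridges :
    ((∃ (Rot : ℝ → (EuclideanSpace ℝ (Fin 3) ≃ₗᵢ[ℝ] EuclideanSpace ℝ (Fin 3))) (ω L C : ℝ)
      (V : EuclideanSpace ℝ (Fin 3) → EuclideanSpace ℝ (Fin 3)) (Q : EuclideanSpace ℝ (Fin 3) → ℝ),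
      (∀ (φ : ℝ) (x : EuclideanSpace ℝ (Fin 3)),
          Rot φ x 0 = Real.cos φ * x 0 - Real.sin φ * x 1 ∧
          Rot φ x 1 = Real.sin φ * x 0 + Real.cos φ * x 1 ∧ Rot φ x 2 = x 2) ∧
      0 < L ∧ ContDiff ℝ (⊤ : ℕ∞) V ∧ ContDiff ℝ (⊤ : ℕ∞) Q ∧
      Literature.Analysis.FluidPDE.VectorCalculus.IsDivFree V ∧
      (∀ y : EuclideanSpace ℝ (Fin 3),
          ω • (Literature.Analysis.FluidPDE.cross (EuclideanSpace.single (2 : Fin 3) (1 : ℝ)) (V y)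
                - fderiv ℝ V y (Literature.Analysis.FluidPDE.cross (EuclideanSpace.single (2 : Fin 3) (1 : ℝ)) y))
            + (1 / 2 : ℝ) • V y + (1 / 2 : ℝ) • fderiv ℝ V y y
            + Literature.Analysis.FluidPDE.convect V V y + gradient Q y
            = Laplacian.laplacian V y) ∧
      (∀ y : EuclideanSpace ℝ (Fin 3), (1 + ‖y‖) * ‖V y‖ ≤ C) ∧
      (∀ y : EuclideanSpace ℝ (Fin 3), |Q y| ≤ C) ∧
      (∃ y : EuclideanSpace ℝ (Fin 3), Rot (ω * L) (V (Rot (-(ω * L)) y)) ≠ V y)) →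
      Summit.NavierStokesRegularity.NavierStokesRegularity.Theses.FilamentSkeletonRss.RssProfileExists) ∧
    ((∃ (α C₀ M : ℝ) (U : EuclideanSpace ℝ (Fin 3) → EuclideanSpace ℝ (Fin 3))
      (P : EuclideanSpace ℝ (Fin 3) → ℝ), α ≠ 0 ∧ U ≠ 0 ∧ ContDiff ℝ (⊤ : ℕ∞) U ∧ ContDiff ℝ (⊤ : ℕ∞) P ∧
      Literature.Analysis.FluidPDE.VectorCalculus.IsDivFree U ∧
      (∀ y : EuclideanSpace ℝ (Fin 3),
        α • (Literature.Analysis.FluidPDE.rotGen (U y) - fderiv ℝ U y (Literature.Analysis.FluidPDE.rotGen y))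
          + (1 / 2 : ℝ) • U y + (1 / 2 : ℝ) • fderiv ℝ U y y - Laplacian.laplacian U y
          + fderiv ℝ U y (U y) + gradient P y = 0) ∧
      (∀ y : EuclideanSpace ℝ (Fin 3), ‖U y‖ ≤ C₀ / (1 + ‖y‖)) ∧
      (∀ y : EuclideanSpace ℝ (Fin 3), |P y| ≤ M)) →
      Summit.NavierStokesRegularity.NavierStokesRegularity.Theses.CorkscrewDynamo.CorkscrewProfile) :=
  ⟨rssProfileExists_of_relativeEquilibrium, corkscrewProfile_of_rotatedLerayProfile⟩

end Summit.NavierStokesRegularity.NavierStokesRegularity.Theorems.CorkscrewProfile.Birth
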